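import Mathlib
import Summits.NavierStokesRegularity.NavierStokesRegularity.Theorems.EulerZoomLiouvillePowerGaugeEulerLiouvilleKelvinPhysical
import Literature.Analysis.FluidPDE.VorticityTransportFormulaProofs
import Literature.Analysis.FluidPDE.ParticleTrajectoryFlow
import Literature.Analysis.FluidPDE.ClassicalSolutionCalculus
import Literature.Analysis.ODE.EvolutionMapHomeomorph
import Literature.Analysis.ODE.EvolutionMapSmooth
import HarnessLib

/-!
# Crux `EulerZoomLiouville.PowerGaugeEulerLiouville` (stmt-NavierStokesRegularity-19832), line `anchored-budget`, stub C1 — part 1: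
# ALONG ONE TRAJECTORY: the backward Grönwall floor under a stretching budget, and the no-escape displacement bound

Route №10 `EulerZoomLiouville` (NavierStokesRegularity), crux E.  Line `anchored-budget` (ideator ns-idea-11 g4;
`Cruxes/PowerGaugeEulerLiouville/Lines/anchored_budget.lean`), stub C1 `stub_anchoredFloorTransport` (seat ns-sfl-p1 g3; split with ns-ezl-w2 g2 who
holds C2).  Setting: a classical Euler flow `u` on `(−∞,0)` (`IsClassicalEulerSolutionOn (Iio 0) 0 u p`) owning its particle flow
(`ODE.IsUniformlyLipschitzOn u (Iio 0)`, which `isUniformlyLipschitzOn_of_gradientBound` derives from the stratum's gradient clause), `X = φ(·, t₀, ·)`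
the trajectory map from a time `t₀ < 0` (`ODE.evolutionMap u t₀`), and an earlier time `t₁ < t₀`.

* `sq_norm_curl_floor_along` — **BACKWARD GRÖNWALL FLOOR**: if `⟪∇u(τ,x) ω, ω⟫ ≤ (K/(−τ) + Λ(τ))|ω|²` on `[t₁,t₀] × ℝ³` with `Λ` integrable, then
  along every trajectory `|ω(t₁, X_{t₁} ξ)|² ≥ |ω(t₀, ξ)|² · e^{−2∫_{(t₁,t₀)} Λ} · ((−t₀)/(−t₁))^{2K}`: the vorticity equation along the flow
  (`hasDerivWithinAt_curl_flow`) gives `(log |ω|²)' = 2⟪∇u ω,ω⟫/|ω|² ≤ 2K/(−τ) + 2Λ`, integrated on `[t₁,t₀]` (`|ω| > 0` along the trajectory by the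
  crude Grönwall bound with the slab's gradient bound);
* `half_le_lintegral_of_escape` — **NO-ESCAPE DISPLACEMENT** (Crippa–De Lellis): a label `ξ`, `‖ξ‖ < a/2`, whose trajectory reaches `‖·‖ ≥ a` at some
  time of `[t₁,t₀]` has travelled at least `a/2` INSIDE `B(0,a)`: `a/2 ≤ ∫_{[t₁,t₀]} 1_{B(0,a)}(X_s ξ) ‖u(s, X_s ξ)‖ ds` (last exit time + FTC).

WHAT THIS IS NOT: not NS, not the crux E — pathwise calculus `--supports` stmt-19832 for ONE stub of ONE line; 19832 OPEN.
[cite: CrippaDeLellis2008, §2–3; MajdaBertozziCUP2002, §1.6 (1.51), §2.5 (2.115)–(2.117)]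
-/

noncomputable section

-- flat `Theorems/<Route><Decl>…` files of one crux share the namespace of the crux (tree convention)
set_option linter.dupNamespace false

open MeasureTheory Set Filter Topology Metric Function InnerProductSpace
open scoped RealInnerProductSpace NNReal ENNReal

namespace Summit.NavierStokesRegularity.NavierStokesRegularity.Theorems.PowerGaugeEulerLiouville.AnchoredBudget

open Literature.Analysis Literature.Analysis.FluidPDE Literature.Analysis.ODE

variable {u : ℝ → EuclideanSpace ℝ (Fin 3) → EuclideanSpace ℝ (Fin 3)} {p : ℝ → EuclideanSpace ℝ (Fin 3) → ℝ}

/-! ### The particle flow is global on `(−∞,0)` -/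

/-- **Flow-owning**: a classical Euler flow on `(−∞,0)` whose gradient is bounded on every compact time interval `[t₁,t₂] ⊆ (−∞,0)` (the clause
of `IsAnchorablePast`) satisfies the Cauchy–Lipschitz hypotheses on `(−∞,0)`. [cite: MajdaBertozziCUP2002, §1.3] -/
theorem isUniformlyLipschitzOn_of_gradientBound (hcl : IsClassicalEulerSolutionOn (Iio 0) 0 u p)
    (hgrad : ∀ t₁ t₂ : ℝ, t₁ < t₂ → t₂ < 0 → ∃ L : ℝ, ∀ τ ∈ Icc t₁ t₂, ∀ x : EuclideanSpace ℝ (Fin 3), ‖fderiv ℝ (u τ) x‖ ≤ L) :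
    ODE.IsUniformlyLipschitzOn u (Iio 0) := by
  refine hcl.smooth_velocity.isUniformlyLipschitzOn_of_norm_fderiv_le fun C hC hCS => ?_
  rcases C.eq_empty_or_nonempty with rfl | hne
  · exact ⟨0, fun t ht => absurd ht (notMem_empty t)⟩
  have hb : sSup C < 0 := hCS (hC.sSup_mem hne)
  obtain ⟨t, htC⟩ := id hne
  have hlt : sInf C - 1 < sSup C := by linarith [csInf_le hC.bddBelow htC, le_csSup hC.bddAbove htC]
  obtain ⟨L, hL⟩ := hgrad (sInf C - 1) (sSup C) hlt hb
  exact ⟨L, fun t ht x => hL t ⟨by linarith [csInf_le hC.bddBelow ht], le_csSup hC.bddAbove ht⟩ x⟩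

/-! ### The backward Grönwall floor along one trajectory -/

/-- **Backward Grönwall floor under a stretching budget.**  For `t₁ < t₀ < 0`, a gradient bound `‖∇u‖ ≤ L_g` on `[t₁,t₀]`, a budget
`⟪∇u(τ,x)ω,ω⟫ ≤ (K/(−τ) + Λ(τ))|ω|²` on `[t₁,t₀] × ℝ³` with `Λ` integrable on `[t₁,t₀]`, and every label `ξ`:
`|ω(t₀,ξ)|² e^{−2∫_{(t₁,t₀)}Λ} ((−t₀)/(−t₁))^{2K} ≤ |ω(t₁, φ(t₁,t₀,ξ))|²`. [cite: MajdaBertozziCUP2002, §1.6 (1.51), §2.5 (2.115)–(2.117)] -/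
theorem sq_norm_curl_floor_along (hcl : IsClassicalEulerSolutionOn (Iio 0) 0 u p) (hL : ODE.IsUniformlyLipschitzOn u (Iio 0))
    {t₁ t₀ : ℝ} (h10 : t₁ < t₀) (ht₀ : t₀ < 0)
    {Lg : ℝ} (hLg : ∀ τ ∈ Icc t₁ t₀, ∀ x : EuclideanSpace ℝ (Fin 3), ‖fderiv ℝ (u τ) x‖ ≤ Lg)
    {K : ℝ} {Λ : ℝ → ℝ} (hΛi : IntegrableOn Λ (Icc t₁ t₀))
    (hS : ∀ τ ∈ Icc t₁ t₀, ∀ x : EuclideanSpace ℝ (Fin 3),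
      ⟪fderiv ℝ (u τ) x (curl (u τ) x), curl (u τ) x⟫ ≤ (K / (-τ) + Λ τ) * ‖curl (u τ) x‖ ^ 2)
    (ξ : EuclideanSpace ℝ (Fin 3)) :
    ‖curl (u t₀) ξ‖ ^ 2 * Real.exp (-(2 * ∫ s in Ioo t₁ t₀, Λ s)) * ((-t₀) / (-t₁)) ^ (2 * K) ≤
      ‖curl (u t₁) (ODE.evolutionMap u t₀ t₁ ξ)‖ ^ 2 := by
  by_cases h0 : curl (u t₀) ξ = 0
  · rw [h0, norm_zero]; simp only [ne_eq, OfNat.ofNat_ne_zero, not_false_eq_true, zero_pow, zero_mul]; positivity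
  have hSc : Convex ℝ (Iio (0 : ℝ)) := convex_Iio 0
  have hU : UniqueDiffOn ℝ (Iio (0 : ℝ)) := uniqueDiffOn_Iio 0
  have ht₀S : t₀ ∈ Iio (0 : ℝ) := ht₀
  have hIcc : Icc t₁ t₀ ⊆ Iio (0 : ℝ) := fun s hs => lt_of_le_of_lt hs.2 ht₀
  set X : ℝ → EuclideanSpace ℝ (Fin 3) → EuclideanSpace ℝ (Fin 3) := ODE.evolutionMap u t₀ with hX
  have hXu : ∀ t ∈ Iio (0 : ℝ), ∀ y, HasDerivWithinAt (fun s => X s y) (u t (X t y)) (Iio 0) t :=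
    fun t ht y => hL.hasDerivWithinAt_evolutionMap hSc ht₀S ht y
  have hX0 : X t₀ ξ = ξ := by rw [hX, ODE.evolutionMap_self]
  -- `c = ω` along the trajectory, `A = ∇u` along the trajectory, `m = |c|²`
  set c : ℝ → EuclideanSpace ℝ (Fin 3) := fun s => curl (u s) (X s ξ) with hc
  set A : ℝ → EuclideanSpace ℝ (Fin 3) →L[ℝ] EuclideanSpace ℝ (Fin 3) := fun s => fderiv ℝ (u s) (X s ξ) with hA
  have hc' : ∀ s ∈ Iio (0 : ℝ), HasDerivAt c (A s (c s)) s := fun s hs =>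
    (hcl.hasDerivWithinAt_curl_flow hU hXu hs ξ).hasDerivAt (isOpen_Iio.mem_nhds hs)
  set m : ℝ → ℝ := fun s => ‖c s‖ ^ 2 with hm
  have hm' : ∀ s ∈ Iio (0 : ℝ), HasDerivAt m (2 * ⟪c s, A s (c s)⟫) s := fun s hs => (hc' s hs).norm_sq
  have hmt₀ : m t₀ = ‖curl (u t₀) ξ‖ ^ 2 := by simp only [hm, hc, hX0]
  have hmt₀pos : 0 < m t₀ := by rw [hmt₀]; exact pow_pos (norm_pos_iff.2 h0) 2
  -- continuity of the data along the trajectory on `[t₁,t₀]`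
  have hXc : ContinuousOn (fun s => X s ξ) (Iio 0) := fun s hs => (hXu s hs ξ).continuousWithinAt
  have hcc : ContinuousOn c (Icc t₁ t₀) := fun s hs => (hc' s (hIcc hs)).continuousAt.continuousWithinAt
  have hmc : ContinuousOn m (Icc t₁ t₀) := hcc.norm.pow 2
  have hAc : ContinuousOn A (Icc t₁ t₀) := by
    have h1 := (hcl.smooth_velocity.fderiv_slice hU).continuousOn
    have h2 : ContinuousOn (fun s : ℝ => ((s, X s ξ) : ℝ × EuclideanSpace ℝ (Fin 3))) (Iio 0) := continuousOn_id.prodMk hXc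
    exact (h1.comp h2 fun s hs => mk_mem_prod hs (mem_univ _)).mono hIcc
  have hqc : ContinuousOn (fun s => 2 * ⟪c s, A s (c s)⟫) (Icc t₁ t₀) :=
    continuousOn_const.mul (hcc.inner (hAc.clm_apply hcc))
  -- Step 1: `m > 0` on `[t₁,t₀]` (crude Grönwall with the gradient bound)
  have hLg0 : 0 ≤ Lg := (norm_nonneg _).trans (hLg t₀ (right_mem_Icc.2 h10.le) 0)
  have hqle : ∀ s ∈ Icc t₁ t₀, 2 * ⟪c s, A s (c s)⟫ ≤ 2 * Lg * m s := by
    intro s hs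
    have h1 : ⟪c s, A s (c s)⟫ ≤ ‖c s‖ * ‖A s (c s)‖ := real_inner_le_norm _ _
    have h2 : ‖A s (c s)‖ ≤ Lg * ‖c s‖ := (A s).le_of_opNorm_le (hLg s hs _) _
    have h3 : m s = ‖c s‖ ^ 2 := rfl
    nlinarith [norm_nonneg (c s)]
  set F₁ : ℝ → ℝ := fun s => Real.exp (2 * Lg * (t₀ - s)) * m s with hF₁
  have hE' : ∀ s : ℝ, HasDerivAt (fun r : ℝ => Real.exp (2 * Lg * (t₀ - r))) (Real.exp (2 * Lg * (t₀ - s)) * (2 * Lg * (-1))) s := by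
    intro s
    have h := ((hasDerivAt_id s).const_sub t₀).const_mul (2 * Lg)
    exact (h.exp).congr_deriv (by simp)
  have hF₁' : ∀ s ∈ Iio (0 : ℝ), HasDerivAt F₁
      (Real.exp (2 * Lg * (t₀ - s)) * (2 * Lg * (-1)) * m s + Real.exp (2 * Lg * (t₀ - s)) * (2 * ⟪c s, A s (c s)⟫)) s :=
    fun s hs => (hE' s).mul (hm' s hs)
  have hanti : AntitoneOn F₁ (Icc t₁ t₀) := by
    refine antitoneOn_of_hasDerivWithinAt_nonpos (convex_Icc t₁ t₀)
      (fun s hs => (hF₁' s (hIcc hs)).continuousAt.continuousWithinAt)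
      (fun s hs => (hF₁' s (hIcc (interior_subset hs))).hasDerivWithinAt) fun s hs => ?_
    have hs' : s ∈ Icc t₁ t₀ := interior_subset hs
    have hpos := Real.exp_pos (2 * Lg * (t₀ - s))
    have := hqle s hs'
    nlinarith [mul_le_mul_of_nonneg_left this hpos.le]
  have hmpos : ∀ s ∈ Icc t₁ t₀, 0 < m s := by
    intro s hs
    have h1 : F₁ t₀ ≤ F₁ s := hanti hs (right_mem_Icc.2 h10.le) hs.2
    have h2 : F₁ t₀ = m t₀ := by simp only [hF₁, sub_self, mul_zero, Real.exp_zero, one_mul]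
    rw [h2] at h1
    have hpos := Real.exp_pos (2 * Lg * (t₀ - s))
    by_contra hneg
    rw [not_lt] at hneg
    have : F₁ s ≤ 0 := mul_nonpos_of_nonneg_of_nonpos hpos.le hneg
    linarith
  -- Step 2: `(log m)' ≤ 2K/(−s) + 2Λ`, integrated on `[t₁,t₀]`
  set f : ℝ → ℝ := fun s => Real.log (m s) with hf
  have hf' : ∀ s ∈ Icc t₁ t₀, HasDerivAt f (2 * ⟪c s, A s (c s)⟫ / m s) s := by
    intro s hs
    have h := (Real.hasDerivAt_log (hmpos s hs).ne').comp s (hm' s (hIcc hs))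
    exact h.congr_deriv (by rw [div_eq_inv_mul])
  have hf'c : ContinuousOn (fun s => 2 * ⟪c s, A s (c s)⟫ / m s) (Icc t₁ t₀) :=
    hqc.div hmc fun s hs => (hmpos s hs).ne'
  have hFTC : ∫ s in t₁..t₀, 2 * ⟪c s, A s (c s)⟫ / m s = f t₀ - f t₁ :=
    intervalIntegral.integral_eq_sub_of_hasDerivAt (fun s hs => hf' s (by rwa [uIcc_of_le h10.le] at hs))
      (hf'c.intervalIntegrable_of_Icc h10.le)
  have hbound : ∀ s ∈ Icc t₁ t₀, 2 * ⟪c s, A s (c s)⟫ / m s ≤ 2 * (K / (-s) + Λ s) := by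
    intro s hs
    rw [div_le_iff₀ (hmpos s hs)]
    have h := hS s hs (X s ξ)
    rw [real_inner_comm] at h
    have h3 : m s = ‖c s‖ ^ 2 := rfl
    rw [h3]
    nlinarith
  have ht₁0 : t₁ < 0 := h10.trans ht₀
  have hgi : IntervalIntegrable (fun s => 2 * (K / (-s) + Λ s)) volume t₁ t₀ := by
    refine ((ContinuousOn.intervalIntegrable_of_Icc h10.le ?_).add ?_).const_mul 2
    · exact continuousOn_const.div continuousOn_id.neg fun s hs => by have := hIcc hs; simp only [mem_Iio] at this; linarith
    · exact (hΛi.mono_set (by rw [uIcc_of_le h10.le])).intervalIntegrable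
  have hmono := intervalIntegral.integral_mono_on h10.le (hf'c.intervalIntegrable_of_Icc h10.le) hgi hbound
  have hval : ∫ s in t₁..t₀, 2 * (K / (-s) + Λ s) = -(2 * K) * Real.log (t₀ / t₁) + 2 * ∫ s in t₁..t₀, Λ s := by
    have hI1 : IntervalIntegrable (fun s : ℝ => K / (-s)) volume t₁ t₀ :=
      ContinuousOn.intervalIntegrable_of_Icc h10.le
        (continuousOn_const.div continuousOn_id.neg fun s hs => by have := hIcc hs; simp only [mem_Iio] at this; linarith)
    have hI2 : IntervalIntegrable Λ volume t₁ t₀ := (hΛi.mono_set (by rw [uIcc_of_le h10.le])).intervalIntegrable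
    have e1 : (fun s : ℝ => 2 * (K / (-s) + Λ s)) = fun s => 2 * (K / (-s)) + 2 * Λ s := by funext s; ring
    rw [e1, intervalIntegral.integral_add (hI1.const_mul 2) (hI2.const_mul 2), intervalIntegral.integral_const_mul,
      intervalIntegral.integral_const_mul]
    have e2 : (fun s : ℝ => K / (-s)) = fun s => -K * s⁻¹ := by funext s; rw [div_neg, div_eq_mul_inv, neg_mul]
    rw [e2, intervalIntegral.integral_const_mul, integral_inv_of_neg ht₁0 ht₀]
    ring
  rw [hFTC, hval] at hmono
  -- Step 3: exponentiate
  have hratio : 0 < t₀ / t₁ := div_pos_of_neg_of_neg ht₀ ht₁0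
  have hIoo : ∫ s in Ioo t₁ t₀, Λ s = ∫ s in t₁..t₀, Λ s := by
    rw [intervalIntegral.integral_of_le h10.le, integral_Ioc_eq_integral_Ioo]
  have hm₁ : m t₁ = ‖curl (u t₁) (ODE.evolutionMap u t₀ t₁ ξ)‖ ^ 2 := rfl
  rw [← hm₁, ← hmt₀, hIoo, show (-t₀) / (-t₁) = t₀ / t₁ by rw [neg_div_neg_eq], Real.rpow_def_of_pos hratio,
    ← Real.exp_log hmt₀pos, ← Real.exp_add, ← Real.exp_add, ← Real.exp_log (hmpos t₁ (left_mem_Icc.2 h10.le))]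
  rw [Real.exp_le_exp]
  have e3 : f t₀ = Real.log (m t₀) := rfl
  have e4 : f t₁ = Real.log (m t₁) := rfl
  linarith

/-! ### No escape without displacement -/

/-- **A label that escapes `B(0,a)` has travelled `a/2` inside it** (the step behind the Crippa–De Lellis no-escape bound): for `t₁ ≤ t₀ < 0`,
a label `ξ` with `‖ξ‖ < a/2` whose trajectory `s ↦ φ(s,t₀,ξ)` has `‖φ(s,t₀,ξ)‖ ≥ a` for some `s ∈ [t₁,t₀]` satisfies
`a/2 ≤ ∫_{[t₁,t₀]} 1_{B(0,a)}(φ(s,t₀,ξ)) ‖u(s, φ(s,t₀,ξ))‖ ds` (after the LAST such time the path runs inside the ball from norm `a` to norm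
`< a/2`). [cite: CrippaDeLellis2008, §2 (no-escape estimate)] -/
theorem half_le_lintegral_of_escape (hcl : IsClassicalEulerSolutionOn (Iio 0) 0 u p) (hL : ODE.IsUniformlyLipschitzOn u (Iio 0))
    {t₁ t₀ : ℝ} (ht₀ : t₀ < 0) {a : ℝ} {ξ : EuclideanSpace ℝ (Fin 3)} (hξ : ‖ξ‖ < a / 2)
    (hesc : ∃ s ∈ Icc t₁ t₀, a ≤ ‖ODE.evolutionMap u t₀ s ξ‖) :
    ENNReal.ofReal (a / 2) ≤
      ∫⁻ s in Icc t₁ t₀, (ball (0 : EuclideanSpace ℝ (Fin 3)) a).indicator (fun y => ‖u s y‖ₑ) (ODE.evolutionMap u t₀ s ξ) := by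
  have hSc : Convex ℝ (Iio (0 : ℝ)) := convex_Iio 0
  have ht₀S : t₀ ∈ Iio (0 : ℝ) := ht₀
  have hIcc : Icc t₁ t₀ ⊆ Iio (0 : ℝ) := fun s hs => lt_of_le_of_lt hs.2 ht₀
  set γ : ℝ → EuclideanSpace ℝ (Fin 3) := fun s => ODE.evolutionMap u t₀ s ξ with hγ
  have hγ' : ∀ s ∈ Iio (0 : ℝ), HasDerivAt γ (u s (γ s)) s := fun s hs =>
    (hL.hasDerivWithinAt_evolutionMap hSc ht₀S hs ξ).hasDerivAt (isOpen_Iio.mem_nhds hs)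
  have hγt₀ : γ t₀ = ξ := by simp only [hγ, ODE.evolutionMap_self]
  have hγc : ContinuousOn γ (Icc t₁ t₀) := fun s hs => (hγ' s (hIcc hs)).continuousAt.continuousWithinAt
  -- the last exit time `σ`
  set S' : Set ℝ := Icc t₁ t₀ ∩ (fun s => ‖γ s‖) ⁻¹' Ici a with hS'
  have hS'cl : IsClosed S' := hγc.norm.preimage_isClosed_of_isClosed isClosed_Icc isClosed_Ici
  have hS'c : IsCompact S' := isCompact_Icc.of_isClosed_subset hS'cl inter_subset_left
  obtain ⟨s₁, hs₁, hfar⟩ := hesc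
  have hne : S'.Nonempty := ⟨s₁, hs₁, hfar⟩
  set σ : ℝ := sSup S' with hσdef
  have hσ : σ ∈ S' := hS'c.sSup_mem hne
  have hσle : ∀ s ∈ S', s ≤ σ := fun s hs => le_csSup hS'c.bddAbove hs
  have ha0 : 0 < a := by linarith [norm_nonneg ξ]
  have hσa : a ≤ ‖γ σ‖ := hσ.2
  have hσt₀ : σ < t₀ := by
    rcases hσ.1.2.eq_or_lt with h | h
    · exfalso; rw [h, hγt₀] at hσa; linarith
    · exact h
  have hin : ∀ s ∈ Ioc σ t₀, ‖γ s‖ < a := by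
    intro s hs
    by_contra h
    rw [not_lt] at h
    exact absurd (hσle s ⟨⟨hσ.1.1.trans hs.1.le, hs.2⟩, h⟩) (not_le.2 hs.1)
  -- FTC on `[σ, t₀]` and the triangle inequality
  have hIcc' : Icc σ t₀ ⊆ Iio (0 : ℝ) := fun s hs => lt_of_le_of_lt hs.2 ht₀
  have hderiv : ∀ s ∈ uIcc σ t₀, HasDerivAt γ (u s (γ s)) s := fun s hs => hγ' s (hIcc' (by rwa [uIcc_of_le hσt₀.le] at hs))
  have hugc : ContinuousOn (fun s => u s (γ s)) (Icc σ t₀) := by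
    have h1 := hcl.smooth_velocity.continuousOn
    have hγc' : ContinuousOn γ (Icc σ t₀) := fun s hs => (hγ' s (hIcc' hs)).continuousAt.continuousWithinAt
    have h2 : ContinuousOn (fun s : ℝ => ((s, γ s) : ℝ × EuclideanSpace ℝ (Fin 3))) (Icc σ t₀) := continuousOn_id.prodMk hγc'
    exact h1.comp h2 fun s hs => mk_mem_prod (hIcc' hs) (mem_univ _)
  have hFTC := intervalIntegral.integral_eq_sub_of_hasDerivAt hderiv (hugc.intervalIntegrable_of_Icc hσt₀.le)
  have hnorm : a / 2 ≤ ∫ s in σ..t₀, ‖u s (γ s)‖ := by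
    have h1 : ‖γ σ‖ - ‖γ t₀‖ ≤ ‖γ t₀ - γ σ‖ := by rw [← norm_neg (γ t₀ - γ σ), neg_sub]; exact norm_sub_norm_le _ _
    have h2 : ‖γ t₀ - γ σ‖ ≤ ∫ s in σ..t₀, ‖u s (γ s)‖ := by
      rw [← hFTC]; exact intervalIntegral.norm_integral_le_integral_norm hσt₀.le
    rw [hγt₀] at h1 h2
    linarith
  -- pass to the Lebesgue integral over `Ioc σ t₀ ⊆ Icc t₁ t₀` and insert the indicator
  have hint : IntegrableOn (fun s => ‖u s (γ s)‖) (Ioc σ t₀) := (hugc.norm.integrableOn_Icc).mono_set Ioc_subset_Icc_self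
  have h3 : ENNReal.ofReal (∫ s in σ..t₀, ‖u s (γ s)‖) = ∫⁻ s in Ioc σ t₀, ‖u s (γ s)‖ₑ := by
    rw [intervalIntegral.integral_of_le hσt₀.le, ofReal_integral_eq_lintegral_ofReal hint (Eventually.of_forall fun s => norm_nonneg _)]
    simp_rw [ofReal_norm]
  calc ENNReal.ofReal (a / 2) ≤ ENNReal.ofReal (∫ s in σ..t₀, ‖u s (γ s)‖) := ENNReal.ofReal_le_ofReal hnorm
    _ = ∫⁻ s in Ioc σ t₀, ‖u s (γ s)‖ₑ := h3
    _ = ∫⁻ s in Ioc σ t₀, (ball (0 : EuclideanSpace ℝ (Fin 3)) a).indicator (fun y => ‖u s y‖ₑ) (γ s) := by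
        refine setLIntegral_congr_fun measurableSet_Ioc fun s hs => ?_
        rw [indicator_of_mem (mem_ball_zero_iff.2 (hin s hs))]
    _ ≤ ∫⁻ s in Icc t₁ t₀, (ball (0 : EuclideanSpace ℝ (Fin 3)) a).indicator (fun y => ‖u s y‖ₑ) (γ s) :=
        lintegral_mono_set fun s hs => ⟨hσ.1.1.trans hs.1.le, hs.2⟩

end Summit.NavierStokesRegularity.NavierStokesRegularity.Theorems.PowerGaugeEulerLiouville.AnchoredBudget

end
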